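import Literature.Analysis.FluidPDE.KochTataruPointwise
import Literature.Analysis.FunctionSpaces.BMOCarlesonConverse
import HarnessLib

/-!
# Koch–Tataru's Duhamel term under the heat flow: the `τ^{-1/2}` decay of the shifted majorant

Analysis/FluidPDE proof companion of `Literature/Analysis/FluidPDE/KochTataru.lean` (the
decomposition of the named fact `Literature.Analysis.FluidPDE.koch_tataru`, **ns.S15**,
Koch–Tataru, Adv. Math. 157 (2001), Theorem 2) and of `KochTataruPointwise.lean` (the pointwise
half of Lemma 3.2: `∫∫_{(0,t)×E} ‖K(t - s, x - y)[u, v]‖ ≤ C t^{-1/2} ‖u‖_X ‖v‖_X`, absolute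
convergence and measurability of `B(u, v) = kochTataruBilinear u v`). For the fact (T4)
`integral_of_isKochTataruSolution` ("class solutions solve the integral equation") one needs the
Duhamel term to **vanish at infinity** in the sense of Lemarié-Rieusset 2016, Def. 6.5:
`e^{τΔ} B(v, v)(t) → 0` as `τ → ∞`. By the semigroup law for the kernel
(`KochTataruKernelCalculus.lean`) `e^{τΔ}B(v,v)(t, x) = ∫∫_{(0,t)×E} K(t - s + τ, x - y)[v, v]`,
and this file proves the estimate that drives the decay of the right-hand side:

* `§ Weighted`: for `t > 0`, `τ ≥ 0`, the **near part** (`t/2 ≤ s < t`, sup part of the norm)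
  `∫∫ (t - s + τ + |x - y|²)^{-(d+1)/2} |w|² ≤ (2M_d/t) ‖w‖_X² ∫_{t/2}^t (t - s + τ)^{-1/2} ds`
  (`lintegral_near_shiftedWeight_mul_enorm_sq_le`; `M_d = parabolicWeightMass E`), the **far
  part** (`s < t/2`, where `t - s + τ ≥ t/2 + τ > t/2`, the shell estimate
  `setLIntegral_shellWeight_mul_le` of `KochTataruPointwise.lean` at radius `(t/2 + τ)^{1/2}`):
  `≤ 2^{d+2} (t/2 + τ)^{-1/2} ‖w‖_X²` for `τ > 0` (`lintegral_far_shiftedWeight_mul_enorm_sq_le`),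
  whence `J_τ(w) := ∫∫_{(0,t)×E} (t - s + τ + |x - y|²)^{-(d+1)/2} |w|² ≤ (M_d + 2^{d+2}) τ^{-1/2} ‖w‖_X²`
  (`lintegral_shiftedWeight_mul_enorm_sq_le'`);
* `§ Duhamel`: by Koch–Tataru's (14) and Cauchy–Schwarz,
  `∫∫ ‖K(t - s + τ, x - y)[u, v]‖ ≤ C_K J_τ(u)^{1/2} J_τ(v)^{1/2}`
  (`lintegral_enorm_oseenKernel_shifted_le_sqrt`, any `τ ≥ 0`), so
  **`∫∫_{(0,t)×E} ‖K(t - s + τ, x - y)[u(s,y), v(s,y)]‖ ≤ C τ^{-1/2} ‖u‖_X ‖v‖_X`** for `τ > 0`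
  (`exists_lintegral_enorm_oseenKernel_shifted_le'`) and the shifted integrand is integrable
  (`integrable_oseenKernel_shifted`); plus the bookkeeping used by (T4): `B(u, v)(t, x)` as a
  product integral (`kochTataruBilinear_eq_integral_prod`, Fubini under the absolute convergence
  of `KochTataruPointwise.lean`), the real-valued form of Koch–Tataru's pointwise estimate (12)
  (`exists_norm_kochTataruBilinear_le_rpow`; the `∃ B` form is `exists_norm_kochTataruBilinear_le` of
  `KochTataruPairing.lean`).

## Mathlib / tree search

Tree: `KochTataruPointwise.lean` (`setLIntegral_shellWeight_mul_le`,
`exists_lintegral_enorm_oseenKernel_duhamel_le`, `integrable_oseenKernel_duhamel`,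
`exists_enorm_kochTataruBilinear_le`, `lintegral_weight_sub_left`), `KochTataruKernel.lean`
(`exists_enorm_oseenKernel_le`, `measurable_oseenKernel`, `lintegral_add_norm_sq_rpow_neg`,
`integral_one_add_norm_sq_rpow_neg_pos`), `KochTataruFixedPoint.lean` (`ae_enorm_slice_le`),
`BMOInv.setLIntegral_prod_le`, `BMOInv.lintegral_mul_le_rpow_half_mul_rpow_half`
(`BMOCarlesonConverse`), `volume_restrict_prod_univ_eq_prod` (`KatoUniquenessDual`). Mathlib:
`lintegral_union_le`, `Ioo_ae_eq_Ico`, `integral_prod`, `norm_integral_le_lintegral_norm`. The `τ = 0` statements are those of `KochTataruPointwise.lean`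
and are not repeated (`lean search 'shifted|nearTime|shellWeight'`).

## References

* H. Koch, D. Tataru, *Well-posedness for the Navier–Stokes equations*, Adv. Math. 157 (2001)
  22–35, §1 (3), §3 ((11), (12), (14), Lemma 3.2 and its proof). Bib key `KochTataruAdvMath2001`.
* P. G. Lemarié-Rieusset, *The Navier–Stokes problem in the 21st century*, CRC Press 2016,
  Def. 6.5 (distributions vanishing at infinity: `e^{τΔ}F → 0`), Thm. 6.1. Bib key
  `LemarieRieusset2016`.
-/

noncomputable section

open MeasureTheory Set Function Filter Metric
open _root_.Topology _root_.Real
open scoped ENNReal NNReal RealInnerProductSpace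

namespace Literature.Analysis.FluidPDE

variable {E : Type*} [NormedAddCommGroup E] [InnerProductSpace ℝ E] [FiniteDimensional ℝ E]
  [MeasurableSpace E] [BorelSpace E]

/-! ## The weighted space–time size of a field of finite path norm -/

section Weighted

variable (E) in
/-- The dimensional constant `M_d = ∫ (1 + ‖w‖²)^{-(d+1)/2} dw ∈ (0, ∞)`. [folklore] -/
def parabolicWeightMass : ℝ :=
  ∫ w : E, (1 + ‖w‖ ^ 2) ^ (-(((Module.finrank ℝ E : ℝ) + 1) / 2))

/-- `M_d > 0`. [folklore] -/
theorem parabolicWeightMass_pos : 0 < parabolicWeightMass E :=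
  integral_one_add_norm_sq_rpow_neg_pos (by linarith)

/-- **The spatial integral of the parabolic weight**: for `σ > 0`,
`∫ (σ + ‖x - y‖²)^{-(d+1)/2} dy = σ^{-1/2} M_d` (parabolic scaling). [folklore] -/
theorem lintegral_parabolicWeight_eq {σ : ℝ} (hσ : 0 < σ) (x : E) :
    ∫⁻ y, ENNReal.ofReal ((σ + ‖x - y‖ ^ 2) ^ (-((Module.finrank ℝ E : ℝ) + 1) / 2)) =
      ENNReal.ofReal (σ ^ (-(1 / 2 : ℝ)) * parabolicWeightMass E) := by
  set d : ℝ := (Module.finrank ℝ E : ℝ) with hd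
  have he : d < 2 * ((d + 1) / 2) := by linarith
  have h := lintegral_add_norm_sq_rpow_neg (E := E) he hσ
  rw [show d / 2 - (d + 1) / 2 = -(1 / 2 : ℝ) by ring] at h
  rw [lintegral_sub_left_eq_self (fun z : E =>
    ENNReal.ofReal ((σ + ‖z‖ ^ 2) ^ (-(d + 1) / 2))) x]
  simp_rw [neg_div] at h ⊢
  exact h

/-- **The near part** (`t/2 ≤ s < t`, the `L^∞` part of the path norm): for `t > 0`, `τ ≥ 0`,
`∫∫_{[t/2,t) × E} (t - s + τ + |x - y|²)^{-(d+1)/2} |w|² ≤ (2M_d/t) ‖w‖_X² ∫_{t/2}^t (t - s + τ)^{-1/2} ds`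
(`|w(s, y)|² ≤ ‖w‖_X²/s ≤ 2‖w‖_X²/t` a.e. and the spatial integral of the weight).
[cite: KochTataruAdvMath2001, Lemma 3.2 (proof)] -/
theorem lintegral_near_shiftedWeight_mul_enorm_sq_le (w : ℝ → E → E) (x : E) {t τ : ℝ}
    (ht : 0 < t) (hτ : 0 ≤ τ) :
    ∫⁻ p in Ico (t / 2) t ×ˢ (univ : Set E),
        ENNReal.ofReal ((t - p.1 + τ + ‖x - p.2‖ ^ 2) ^ (-((Module.finrank ℝ E : ℝ) + 1) / 2)) *
          ‖w p.1 p.2‖ₑ ^ 2 ≤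
      ENNReal.ofReal (2 * parabolicWeightMass E / t) * eKochTataruNorm w ^ 2 *
        ∫⁻ s in Ioo (t / 2) t, ENNReal.ofReal ((t - s + τ) ^ (-(1 / 2 : ℝ))) := by
  set d : ℝ := (Module.finrank ℝ E : ℝ) with hd
  set N := eKochTataruNorm w with hN
  set M := parabolicWeightMass E with hM
  set G : ℝ × E → ℝ≥0∞ := fun p =>
    ENNReal.ofReal ((t - p.1 + τ + ‖x - p.2‖ ^ 2) ^ (-(d + 1) / 2)) * ‖w p.1 p.2‖ₑ ^ 2 with hG
  have hmeasω : ∀ s, Measurable fun y : E =>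
      ENNReal.ofReal ((t - s + τ + ‖x - y‖ ^ 2) ^ (-(d + 1) / 2)) := fun s =>
    ((by fun_prop : Measurable fun y : E => t - s + τ + ‖x - y‖ ^ 2).pow_const _).ennreal_ofReal
  -- per-slice bound
  have hslice : ∀ s ∈ Ioo (t / 2) t, ∫⁻ y, G (s, y) ≤
      ENNReal.ofReal (2 * M / t) * N ^ 2 * ENNReal.ofReal ((t - s + τ) ^ (-(1 / 2 : ℝ))) := by
    intro s hs
    have hs0 : 0 < s := by linarith [hs.1]
    have hσ : 0 < t - s + τ := by linarith [hs.2]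
    have hbd := ae_enorm_slice_le w hs0
    -- `(ofReal √s)⁻¹² ≤ ofReal (2/t)`
    have hinv : ((ENNReal.ofReal (Real.sqrt s))⁻¹) ^ 2 ≤ ENNReal.ofReal (2 / t) := by
      rw [← ENNReal.ofReal_inv_of_pos (Real.sqrt_pos.2 hs0), ← ENNReal.ofReal_pow (by positivity)]
      refine ENNReal.ofReal_le_ofReal ?_
      rw [inv_pow, Real.sq_sqrt hs0.le, inv_eq_one_div, div_le_div_iff₀ hs0 ht]
      linarith [hs.1]
    calc ∫⁻ y, G (s, y)
        ≤ ∫⁻ y, ENNReal.ofReal ((t - s + τ + ‖x - y‖ ^ 2) ^ (-(d + 1) / 2)) *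
            ((ENNReal.ofReal (Real.sqrt s))⁻¹ * N) ^ 2 := by
          refine lintegral_mono_ae (hbd.mono fun y hy => ?_)
          simp only [hG]
          gcongr
      _ = ENNReal.ofReal ((t - s + τ) ^ (-(1 / 2 : ℝ)) * M) *
            (((ENNReal.ofReal (Real.sqrt s))⁻¹) ^ 2 * N ^ 2) := by
          rw [lintegral_mul_const _ (hmeasω s), lintegral_parabolicWeight_eq hσ x, mul_pow]
      _ ≤ ENNReal.ofReal ((t - s + τ) ^ (-(1 / 2 : ℝ)) * M) * (ENNReal.ofReal (2 / t) * N ^ 2) := by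
          gcongr
      _ = ENNReal.ofReal (2 * M / t) * N ^ 2 * ENNReal.ofReal ((t - s + τ) ^ (-(1 / 2 : ℝ))) := by
          rw [ENNReal.ofReal_mul (Real.rpow_nonneg hσ.le _),
            show (2 * M / t : ℝ) = M * (2 / t) by ring,
            ENNReal.ofReal_mul (parabolicWeightMass_pos (E := E)).le]
          ring
  -- integrate in `s`
  calc ∫⁻ p in Ico (t / 2) t ×ˢ (univ : Set E), G p
      ≤ ∫⁻ s in Ico (t / 2) t, ∫⁻ y in (univ : Set E), G (s, y) :=
        FunctionSpaces.BMOInv.setLIntegral_prod_le G _ _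
    _ = ∫⁻ s in Ioo (t / 2) t, ∫⁻ y, G (s, y) := by
        rw [setLIntegral_congr Ioo_ae_eq_Ico.symm]
        simp only [Measure.restrict_univ]
    _ ≤ ∫⁻ s in Ioo (t / 2) t, ENNReal.ofReal (2 * M / t) * N ^ 2 *
          ENNReal.ofReal ((t - s + τ) ^ (-(1 / 2 : ℝ))) :=
        setLIntegral_mono' measurableSet_Ioo hslice
    _ = ENNReal.ofReal (2 * M / t) * N ^ 2 *
          ∫⁻ s in Ioo (t / 2) t, ENNReal.ofReal ((t - s + τ) ^ (-(1 / 2 : ℝ))) := by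
        rw [lintegral_const_mul]
        exact ((by fun_prop : Measurable fun s : ℝ => t - s + τ).pow_const _).ennreal_ofReal

/-- **The far part** (`0 < s < t/2`, the Carleson part of the path norm via the shell estimate
`setLIntegral_shellWeight_mul_le` of `KochTataruPointwise.lean`): for `t > 0`, `τ > 0` and `w`
measurable on `(0, ∞) × E`,
`∫∫_{(0,t/2) × E} (t - s + τ + |x - y|²)^{-(d+1)/2} |w|² ≤ 2^{d+2} (t/2 + τ)^{-1/2} ‖w‖_X²`
(there `t - s + τ ≥ t/2 + τ =: ρ²` and `t/2 < ρ²`). [cite: KochTataruAdvMath2001, Lemma 3.2 (proof)] -/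
theorem lintegral_far_shiftedWeight_mul_enorm_sq_le {w : ℝ → E → E}
    (hw : AEStronglyMeasurable (uncurry w) ((volume : Measure (ℝ × E)).restrict (Ioi 0 ×ˢ univ)))
    (x : E) {t τ : ℝ} (ht : 0 < t) (hτ : 0 < τ) :
    ∫⁻ p in Ioo 0 (t / 2) ×ˢ (univ : Set E),
        ENNReal.ofReal ((t - p.1 + τ + ‖x - p.2‖ ^ 2) ^ (-((Module.finrank ℝ E : ℝ) + 1) / 2)) *
          ‖w p.1 p.2‖ₑ ^ 2 ≤
      ENNReal.ofReal (2 ^ (Module.finrank ℝ E + 2) * (t / 2 + τ) ^ (-(1 / 2 : ℝ))) *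
        eKochTataruNorm w ^ 2 := by
  set d : ℕ := Module.finrank ℝ E with hd
  set ρ : ℝ := Real.sqrt (t / 2 + τ) with hρ
  have hρ0 : 0 < ρ := Real.sqrt_pos.2 (by linarith)
  have hρ2 : ρ ^ 2 = t / 2 + τ := Real.sq_sqrt (by linarith)
  have hρinv : ρ⁻¹ = (t / 2 + τ) ^ (-(1 / 2 : ℝ)) := by
    rw [hρ, Real.sqrt_eq_rpow, ← Real.rpow_neg_one, ← Real.rpow_mul (by linarith)]
    norm_num
  -- pointwise comparison of the weights on the far set
  have hpt : ∀ p ∈ Ioo 0 (t / 2) ×ˢ (univ : Set E),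
      ENNReal.ofReal ((t - p.1 + τ + ‖x - p.2‖ ^ 2) ^ (-((d : ℝ) + 1) / 2)) * ‖w p.1 p.2‖ₑ ^ 2 ≤
        ENNReal.ofReal ((ρ ^ 2 + ‖p.2 - x‖ ^ 2) ^ (-(((d : ℝ) + 1) / 2))) *
          (‖w p.1 p.2‖ₑ * ‖w p.1 p.2‖ₑ) := by
    intro p hp
    have hd0 : (0 : ℝ) ≤ d := Nat.cast_nonneg _
    have hle : (t - p.1 + τ + ‖x - p.2‖ ^ 2) ^ (-((d : ℝ) + 1) / 2) ≤
        (ρ ^ 2 + ‖p.2 - x‖ ^ 2) ^ (-(((d : ℝ) + 1) / 2)) := by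
      rw [neg_div, norm_sub_rev]
      exact Real.rpow_le_rpow_of_nonpos (by positivity) (by rw [hρ2]; linarith [hp.1.2])
        (neg_nonpos.2 (by positivity))
    rw [sq (‖w p.1 p.2‖ₑ)]
    exact mul_le_mul' (ENNReal.ofReal_le_ofReal hle) le_rfl
  calc ∫⁻ p in Ioo 0 (t / 2) ×ˢ (univ : Set E),
        ENNReal.ofReal ((t - p.1 + τ + ‖x - p.2‖ ^ 2) ^ (-((d : ℝ) + 1) / 2)) * ‖w p.1 p.2‖ₑ ^ 2
      ≤ ∫⁻ p in Ioo 0 (t / 2) ×ˢ (univ : Set E),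
          ENNReal.ofReal ((ρ ^ 2 + ‖p.2 - x‖ ^ 2) ^ (-(((d : ℝ) + 1) / 2))) *
            (‖w p.1 p.2‖ₑ * ‖w p.1 p.2‖ₑ) :=
        setLIntegral_mono' (measurableSet_Ioo.prod MeasurableSet.univ) hpt
    _ ≤ ∫⁻ p in Ioc 0 (t / 2) ×ˢ (univ : Set E),
          ENNReal.ofReal ((ρ ^ 2 + ‖p.2 - x‖ ^ 2) ^ (-(((d : ℝ) + 1) / 2))) *
            (‖w p.1 p.2‖ₑ * ‖w p.1 p.2‖ₑ) :=
        lintegral_mono_set (prod_mono Ioo_subset_Ioc_self subset_rfl)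
    _ ≤ ENNReal.ofReal (2 ^ (d + 2) * ρ⁻¹) * eKochTataruNorm w * eKochTataruNorm w :=
        setLIntegral_shellWeight_mul_le hw hw x hρ0 (by rw [hρ2]; linarith)
    _ = _ := by rw [hρinv, mul_assoc, ← sq]

/-- The elementary time integral of the near part, decaying form:
`∫_{t/2}^t (t - s + τ)^{-1/2} ds ≤ (t/2) τ^{-1/2}` for `τ > 0`. [folklore] -/
theorem lintegral_Ioo_sub_add_rpow_le' {t τ : ℝ} (ht : 0 ≤ t) (hτ : 0 < τ) :
    ∫⁻ s in Ioo (t / 2) t, ENNReal.ofReal ((t - s + τ) ^ (-(1 / 2 : ℝ))) ≤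
      ENNReal.ofReal (t / 2 * τ ^ (-(1 / 2 : ℝ))) := by
  calc ∫⁻ s in Ioo (t / 2) t, ENNReal.ofReal ((t - s + τ) ^ (-(1 / 2 : ℝ)))
      ≤ ∫⁻ s in Ioo (t / 2) t, ENNReal.ofReal (τ ^ (-(1 / 2 : ℝ))) := by
        refine setLIntegral_mono' measurableSet_Ioo fun s hs => ENNReal.ofReal_le_ofReal ?_
        exact Real.rpow_le_rpow_of_nonpos hτ (by linarith [hs.2]) (by norm_num)
    _ = ENNReal.ofReal (t / 2 * τ ^ (-(1 / 2 : ℝ))) := by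
        rw [setLIntegral_const, Real.volume_Ioo, show t - t / 2 = t / 2 by ring,
          ← ENNReal.ofReal_mul (by positivity), mul_comm, ENNReal.ofReal_mul (by linarith)]

/-- **The weighted space–time size of a field of finite path norm, decaying form**: for
`t > 0`, `τ > 0` and every `x`,
`∫∫_{(0,t) × E} (t - s + τ + |x - y|²)^{-(d+1)/2} |w(s,y)|² dy ds ≤ (M_d + 2^{d+2}) τ^{-1/2} ‖w‖_X²`
(this is what makes `e^{τΔ}B(w, w)(t) → 0` as `τ → ∞`). [cite: KochTataruAdvMath2001, Lemma 3.2 (proof)] -/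
theorem lintegral_shiftedWeight_mul_enorm_sq_le' {w : ℝ → E → E}
    (hw : AEStronglyMeasurable (uncurry w) ((volume : Measure (ℝ × E)).restrict (Ioi 0 ×ˢ univ)))
    (x : E) {t τ : ℝ} (ht : 0 < t) (hτ : 0 < τ) :
    ∫⁻ p in Ioo 0 t ×ˢ (univ : Set E),
        ENNReal.ofReal ((t - p.1 + τ + ‖x - p.2‖ ^ 2) ^ (-((Module.finrank ℝ E : ℝ) + 1) / 2)) *
          ‖w p.1 p.2‖ₑ ^ 2 ≤
      ENNReal.ofReal ((parabolicWeightMass E + 2 ^ (Module.finrank ℝ E + 2)) * τ ^ (-(1 / 2 : ℝ))) *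
        eKochTataruNorm w ^ 2 := by
  set d : ℕ := Module.finrank ℝ E with hd
  set N := eKochTataruNorm w with hN
  set M := parabolicWeightMass E with hM
  have hM0 : 0 < M := parabolicWeightMass_pos (E := E)
  set G : ℝ × E → ℝ≥0∞ := fun p =>
    ENNReal.ofReal ((t - p.1 + τ + ‖x - p.2‖ ^ 2) ^ (-((d : ℝ) + 1) / 2)) * ‖w p.1 p.2‖ₑ ^ 2 with hG
  have hcover : Ioo 0 t ×ˢ (univ : Set E) ⊆
      Ioo 0 (t / 2) ×ˢ (univ : Set E) ∪ Ico (t / 2) t ×ˢ (univ : Set E) := by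
    rintro ⟨s, y⟩ ⟨hs, -⟩
    rcases lt_or_ge s (t / 2) with h | h
    · exact Or.inl ⟨⟨hs.1, h⟩, mem_univ _⟩
    · exact Or.inr ⟨⟨h, hs.2⟩, mem_univ _⟩
  have hnear := lintegral_near_shiftedWeight_mul_enorm_sq_le w x ht hτ.le
  have hfar := lintegral_far_shiftedWeight_mul_enorm_sq_le hw x ht hτ
  have htime := lintegral_Ioo_sub_add_rpow_le' ht.le hτ
  have hnearC : ENNReal.ofReal (2 * M / t) * N ^ 2 *
      ∫⁻ s in Ioo (t / 2) t, ENNReal.ofReal ((t - s + τ) ^ (-(1 / 2 : ℝ))) ≤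
      ENNReal.ofReal (M * τ ^ (-(1 / 2 : ℝ))) * N ^ 2 := by
    calc ENNReal.ofReal (2 * M / t) * N ^ 2 *
          ∫⁻ s in Ioo (t / 2) t, ENNReal.ofReal ((t - s + τ) ^ (-(1 / 2 : ℝ)))
        ≤ ENNReal.ofReal (2 * M / t) * N ^ 2 * ENNReal.ofReal (t / 2 * τ ^ (-(1 / 2 : ℝ))) := by
          gcongr
      _ = ENNReal.ofReal (M * τ ^ (-(1 / 2 : ℝ))) * N ^ 2 := by
          rw [mul_right_comm, ← ENNReal.ofReal_mul (by positivity)]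
          congr 2
          field_simp
  have hfarC : ENNReal.ofReal (2 ^ (d + 2) * (t / 2 + τ) ^ (-(1 / 2 : ℝ))) * N ^ 2 ≤
      ENNReal.ofReal (2 ^ (d + 2) * τ ^ (-(1 / 2 : ℝ))) * N ^ 2 := by
    have h : (2 : ℝ) ^ (d + 2) * (t / 2 + τ) ^ (-(1 / 2 : ℝ)) ≤ 2 ^ (d + 2) * τ ^ (-(1 / 2 : ℝ)) :=
      mul_le_mul_of_nonneg_left
        (Real.rpow_le_rpow_of_nonpos hτ (by linarith) (by norm_num)) (by positivity)
    exact mul_le_mul' (ENNReal.ofReal_le_ofReal h) le_rfl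
  calc ∫⁻ p in Ioo 0 t ×ˢ (univ : Set E), G p
      ≤ ∫⁻ p in Ioo 0 (t / 2) ×ˢ (univ : Set E) ∪ Ico (t / 2) t ×ˢ (univ : Set E), G p :=
        lintegral_mono_set hcover
    _ ≤ (∫⁻ p in Ioo 0 (t / 2) ×ˢ (univ : Set E), G p) +
          ∫⁻ p in Ico (t / 2) t ×ˢ (univ : Set E), G p := lintegral_union_le _ _ _
    _ ≤ ENNReal.ofReal (2 ^ (d + 2) * τ ^ (-(1 / 2 : ℝ))) * N ^ 2 +
          ENNReal.ofReal (M * τ ^ (-(1 / 2 : ℝ))) * N ^ 2 :=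
        add_le_add (hfar.trans hfarC) (hnear.trans hnearC)
    _ = ENNReal.ofReal ((M + 2 ^ (d + 2)) * τ ^ (-(1 / 2 : ℝ))) * N ^ 2 := by
        rw [← add_mul, ← ENNReal.ofReal_add (by positivity) (by positivity)]
        congr 2
        ring

end Weighted

/-! ## The Duhamel integrand: size, absolute convergence, the `L^∞` bound -/

section Duhamel

/-- Restriction of space–time measurability from `(0, ∞) × E` to `(0, t) × E`. [folklore] -/
theorem aestronglyMeasurable_restrict_Ioo_prod {u : ℝ → E → E}
    (hu : AEStronglyMeasurable (uncurry u) ((volume : Measure (ℝ × E)).restrict (Ioi 0 ×ˢ univ)))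
    (t : ℝ) :
    AEStronglyMeasurable (uncurry u) ((volume : Measure (ℝ × E)).restrict (Ioo 0 t ×ˢ univ)) :=
  hu.mono_measure (Measure.restrict_mono (prod_mono Ioo_subset_Ioi_self subset_rfl) le_rfl)

/-- The shifted Duhamel integrand `(s, y) ↦ K(t - s + τ, x - y)[u(s,y), v(s,y)]` is
a.e.-strongly measurable on `(0, t) × E` for space–time measurable `u`, `v`. [folklore] -/
theorem aestronglyMeasurable_oseenKernel_shifted {u v : ℝ → E → E}
    (hu : AEStronglyMeasurable (uncurry u) ((volume : Measure (ℝ × E)).restrict (Ioi 0 ×ˢ univ)))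
    (hv : AEStronglyMeasurable (uncurry v) ((volume : Measure (ℝ × E)).restrict (Ioi 0 ×ˢ univ)))
    (t τ : ℝ) (x : E) :
    AEStronglyMeasurable
      (fun p : ℝ × E => oseenKernel (t - p.1 + τ) (x - p.2) (u p.1 p.2) (v p.1 p.2))
      ((volume : Measure (ℝ × E)).restrict (Ioo 0 t ×ˢ univ)) := by
  have hu' := (aestronglyMeasurable_restrict_Ioo_prod hu t).aemeasurable
  have hv' := (aestronglyMeasurable_restrict_Ioo_prod hv t).aemeasurable
  have hmap : AEMeasurable (fun p : ℝ × E => ((t - p.1 + τ, x - p.2, u p.1 p.2, v p.1 p.2) :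
      ℝ × E × E × E)) ((volume : Measure (ℝ × E)).restrict (Ioo 0 t ×ˢ univ)) := by
    refine (Measurable.aemeasurable (by fun_prop)).prodMk
      ((Measurable.aemeasurable (by fun_prop)).prodMk (hu'.prodMk hv'))
  exact (measurable_oseenKernel.comp_aemeasurable hmap).aestronglyMeasurable

/-- **Koch–Tataru's (14) inside the Duhamel integral, with Cauchy–Schwarz**: for `t > 0`,
`τ ≥ 0`, every `x`, and `u`, `v` measurable on `(0, ∞) × E`,
`∫∫_{(0,t)×E} ‖K(t - s + τ, x - y)[u(s,y), v(s,y)]‖ dy ds ≤ C_K J_τ(u)^{1/2} J_τ(v)^{1/2}` where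
`J_τ(w) = ∫∫ (t - s + τ + |x - y|²)^{-(d+1)/2} |w|²` (Koch–Tataru 2001, proof of Lemma 3.2).
[cite: KochTataruAdvMath2001, Lemma 3.2 (proof)] -/
theorem lintegral_enorm_oseenKernel_shifted_le_sqrt {u v : ℝ → E → E}
    (hu : AEStronglyMeasurable (uncurry u) ((volume : Measure (ℝ × E)).restrict (Ioi 0 ×ˢ univ)))
    (hv : AEStronglyMeasurable (uncurry v) ((volume : Measure (ℝ × E)).restrict (Ioi 0 ×ˢ univ)))
    {C : ℝ} (hC : 0 < C)
    (hK : ∀ {σ : ℝ}, 0 < σ → ∀ z a b : E, ‖oseenKernel σ z a b‖ₑ ≤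
      ENNReal.ofReal (C * (σ + ‖z‖ ^ 2) ^ (-(((Module.finrank ℝ E : ℝ) + 1) / 2))) * ‖a‖ₑ * ‖b‖ₑ)
    (x : E) {t τ : ℝ} (hτ : 0 ≤ τ) :
    ∫⁻ p in Ioo 0 t ×ˢ (univ : Set E), ‖oseenKernel (t - p.1 + τ) (x - p.2) (u p.1 p.2) (v p.1 p.2)‖ₑ ≤
      ENNReal.ofReal C *
        (∫⁻ p in Ioo 0 t ×ˢ (univ : Set E),
          ENNReal.ofReal ((t - p.1 + τ + ‖x - p.2‖ ^ 2) ^ (-((Module.finrank ℝ E : ℝ) + 1) / 2)) *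
            ‖u p.1 p.2‖ₑ ^ 2) ^ (1 / 2 : ℝ) *
        (∫⁻ p in Ioo 0 t ×ˢ (univ : Set E),
          ENNReal.ofReal ((t - p.1 + τ + ‖x - p.2‖ ^ 2) ^ (-((Module.finrank ℝ E : ℝ) + 1) / 2)) *
            ‖v p.1 p.2‖ₑ ^ 2) ^ (1 / 2 : ℝ) := by
  set d : ℝ := (Module.finrank ℝ E : ℝ) with hd
  set μ := (volume : Measure (ℝ × E)).restrict (Ioo 0 t ×ˢ univ) with hμ
  set ω : ℝ × E → ℝ≥0∞ := fun p =>
    ENNReal.ofReal ((t - p.1 + τ + ‖x - p.2‖ ^ 2) ^ (-(d + 1) / 2)) with hω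
  have hωm : Measurable ω :=
    ((by fun_prop : Measurable fun p : ℝ × E => t - p.1 + τ + ‖x - p.2‖ ^ 2).pow_const _).ennreal_ofReal
  set f : ℝ × E → ℝ≥0∞ := fun p => ω p ^ (1 / 2 : ℝ) * ‖u p.1 p.2‖ₑ with hf
  set g : ℝ × E → ℝ≥0∞ := fun p => ω p ^ (1 / 2 : ℝ) * ‖v p.1 p.2‖ₑ with hg
  have hu' := (aestronglyMeasurable_restrict_Ioo_prod hu t).aemeasurable
  have hv' := (aestronglyMeasurable_restrict_Ioo_prod hv t).aemeasurable
  have hfm : AEMeasurable f μ := (hωm.pow_const _).aemeasurable.mul hu'.enorm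
  have hgm : AEMeasurable g μ := (hωm.pow_const _).aemeasurable.mul hv'.enorm
  have hhalf : ∀ a : ℝ≥0∞, a ^ (1 / 2 : ℝ) * a ^ (1 / 2 : ℝ) = a := fun a => by
    rw [← ENNReal.rpow_add_of_nonneg _ _ (by norm_num) (by norm_num)]; norm_num
  have hsq : ∀ a : ℝ≥0∞, (a ^ (1 / 2 : ℝ)) ^ 2 = a := fun a => by rw [sq, hhalf]
  -- pointwise: `‖K‖ₑ ≤ ofReal C * (f * g)` a.e. (time coordinate in `(0, t)`)
  have hpt : ∀ᵐ p ∂μ, ‖oseenKernel (t - p.1 + τ) (x - p.2) (u p.1 p.2) (v p.1 p.2)‖ₑ ≤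
      ENNReal.ofReal C * (f p * g p) := by
    rw [hμ]
    filter_upwards [ae_restrict_mem (measurableSet_Ioo.prod MeasurableSet.univ)] with p hp
    have hσ : 0 < t - p.1 + τ := by linarith [hp.1.2]
    refine (hK hσ _ _ _).trans (le_of_eq ?_)
    rw [ENNReal.ofReal_mul hC.le, show -((d + 1) / 2) = -(d + 1) / 2 by ring]
    simp only [hf, hg]
    calc ENNReal.ofReal C * ω p * ‖u p.1 p.2‖ₑ * ‖v p.1 p.2‖ₑ
        = ENNReal.ofReal C * (ω p ^ (1 / 2 : ℝ) * ω p ^ (1 / 2 : ℝ)) * ‖u p.1 p.2‖ₑ * ‖v p.1 p.2‖ₑ := by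
          rw [hhalf]
      _ = _ := by ring
  calc ∫⁻ p, ‖oseenKernel (t - p.1 + τ) (x - p.2) (u p.1 p.2) (v p.1 p.2)‖ₑ ∂μ
      ≤ ∫⁻ p, ENNReal.ofReal C * (f p * g p) ∂μ := lintegral_mono_ae hpt
    _ = ENNReal.ofReal C * ∫⁻ p, f p * g p ∂μ := lintegral_const_mul' _ _ ENNReal.ofReal_ne_top
    _ ≤ ENNReal.ofReal C * ((∫⁻ p, f p ^ 2 ∂μ) ^ (1 / 2 : ℝ) * (∫⁻ p, g p ^ 2 ∂μ) ^ (1 / 2 : ℝ)) := by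
        gcongr
        exact FunctionSpaces.BMOInv.lintegral_mul_le_rpow_half_mul_rpow_half μ hfm hgm
    _ = _ := by
        simp only [hf, hg, mul_pow, hsq]
        ring

variable (E) in
/-- **The pointwise Duhamel estimate, decaying form**: there is `C = C(E)` such that for all
`u`, `v` measurable on `(0, ∞) × E`, every `t > 0`, `τ > 0` and every `x`,
`∫∫_{(0,t)×E} ‖K(t - s + τ, x - y)[u, v]‖ ≤ C τ^{-1/2} ‖u‖_X ‖v‖_X`: the caloric extension of the
Duhamel term "vanishes at infinity" (Lemarié-Rieusset 2016, Def. 6.5) at the rate `τ^{-1/2}`.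
[cite: KochTataruAdvMath2001, Lemma 3.2] -/
theorem exists_lintegral_enorm_oseenKernel_shifted_le' :
    ∃ C : ℝ, 0 < C ∧ ∀ {u v : ℝ → E → E},
      AEStronglyMeasurable (uncurry u) ((volume : Measure (ℝ × E)).restrict (Ioi 0 ×ˢ univ)) →
      AEStronglyMeasurable (uncurry v) ((volume : Measure (ℝ × E)).restrict (Ioi 0 ×ˢ univ)) →
      ∀ (x : E) {t τ : ℝ}, 0 < t → 0 < τ →
        ∫⁻ p in Ioo 0 t ×ˢ (univ : Set E),
            ‖oseenKernel (t - p.1 + τ) (x - p.2) (u p.1 p.2) (v p.1 p.2)‖ₑ ≤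
          ENNReal.ofReal (C * τ ^ (-(1 / 2 : ℝ))) * eKochTataruNorm u * eKochTataruNorm v := by
  obtain ⟨C, hC, hK⟩ := exists_enorm_oseenKernel_le (E := E)
  set A : ℝ := (parabolicWeightMass E + 2 ^ (Module.finrank ℝ E + 2)) with hA
  have hA0 : 0 < A := by have := parabolicWeightMass_pos (E := E); positivity
  refine ⟨C * A, by positivity, fun {u v} hu hv x {t τ} ht hτ => ?_⟩
  have h := lintegral_enorm_oseenKernel_shifted_le_sqrt hu hv hC hK x (t := t) hτ.le
  have hJu := lintegral_shiftedWeight_mul_enorm_sq_le' hu x ht hτ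
  have hJv := lintegral_shiftedWeight_mul_enorm_sq_le' hv x ht hτ
  refine h.trans ?_
  have hroot : ∀ (w : ℝ → E → E),
      (ENNReal.ofReal (A * τ ^ (-(1 / 2 : ℝ))) * eKochTataruNorm w ^ 2) ^ (1 / 2 : ℝ) =
        ENNReal.ofReal (Real.sqrt (A * τ ^ (-(1 / 2 : ℝ)))) * eKochTataruNorm w := fun w => by
    rw [ENNReal.mul_rpow_of_nonneg _ _ (by norm_num),
      ENNReal.ofReal_rpow_of_nonneg (by positivity) (by norm_num), ← Real.sqrt_eq_rpow,
      ← ENNReal.rpow_natCast, ← ENNReal.rpow_mul]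
    norm_num
  calc ENNReal.ofReal C * (_) ^ (1 / 2 : ℝ) * (_) ^ (1 / 2 : ℝ)
      ≤ ENNReal.ofReal C *
          (ENNReal.ofReal (A * τ ^ (-(1 / 2 : ℝ))) * eKochTataruNorm u ^ 2) ^ (1 / 2 : ℝ) *
          (ENNReal.ofReal (A * τ ^ (-(1 / 2 : ℝ))) * eKochTataruNorm v ^ 2) ^ (1 / 2 : ℝ) := by
        gcongr
    _ = ENNReal.ofReal (C * A * τ ^ (-(1 / 2 : ℝ))) * eKochTataruNorm u * eKochTataruNorm v := by
        rw [hroot u, hroot v]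
        have hs : Real.sqrt (A * τ ^ (-(1 / 2 : ℝ))) * Real.sqrt (A * τ ^ (-(1 / 2 : ℝ))) =
            A * τ ^ (-(1 / 2 : ℝ)) := Real.mul_self_sqrt (by positivity)
        calc ENNReal.ofReal C * (ENNReal.ofReal (Real.sqrt (A * τ ^ (-(1 / 2 : ℝ)))) *
              eKochTataruNorm u) * (ENNReal.ofReal (Real.sqrt (A * τ ^ (-(1 / 2 : ℝ)))) *
              eKochTataruNorm v)
            = ENNReal.ofReal C * (ENNReal.ofReal (Real.sqrt (A * τ ^ (-(1 / 2 : ℝ)))) *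
                ENNReal.ofReal (Real.sqrt (A * τ ^ (-(1 / 2 : ℝ))))) *
                eKochTataruNorm u * eKochTataruNorm v := by ring
          _ = _ := by
              rw [← ENNReal.ofReal_mul (Real.sqrt_nonneg _), hs, ← ENNReal.ofReal_mul hC.le]
              congr 2
              ring

/-- **Absolute convergence of the shifted Duhamel integrand**: for `u`, `v` measurable on
`(0, ∞) × E` with finite path norms, every `t > 0`, `τ > 0` and every `x`,
`(s, y) ↦ K(t - s + τ, x - y)[u(s, y), v(s, y)]` is integrable on `(0, t) × E` (the case `τ = 0`
is `integrable_oseenKernel_duhamel` of `KochTataruPointwise.lean`). [cite: KochTataruAdvMath2001, Lemma 3.2] -/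
theorem integrable_oseenKernel_shifted {u v : ℝ → E → E}
    (hu : AEStronglyMeasurable (uncurry u) ((volume : Measure (ℝ × E)).restrict (Ioi 0 ×ˢ univ)))
    (hv : AEStronglyMeasurable (uncurry v) ((volume : Measure (ℝ × E)).restrict (Ioi 0 ×ˢ univ)))
    (huX : eKochTataruNorm u < ∞) (hvX : eKochTataruNorm v < ∞) {t : ℝ} (ht : 0 < t) {τ : ℝ}
    (hτ : 0 < τ) (x : E) :
    Integrable (fun p : ℝ × E => oseenKernel (t - p.1 + τ) (x - p.2) (u p.1 p.2) (v p.1 p.2))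
      ((volume : Measure (ℝ × E)).restrict (Ioo 0 t ×ˢ univ)) := by
  obtain ⟨C, hC, h⟩ := exists_lintegral_enorm_oseenKernel_shifted_le' E
  refine ⟨aestronglyMeasurable_oseenKernel_shifted hu hv t τ x, ?_⟩
  rw [hasFiniteIntegral_iff_enorm]
  refine (h hu hv x ht hτ).trans_lt ?_
  exact ENNReal.mul_lt_top (ENNReal.mul_lt_top ENNReal.ofReal_lt_top huX) hvX

/-- **The Duhamel term as a product integral**: for fields of finite path norm and `t > 0`,
`B(u, v)(t, x) = ∫∫_{(0,t) × E} K(t - s, x - y)[u(s,y), v(s,y)] d(s, y)` (Fubini under absolute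
convergence). [cite: KochTataruAdvMath2001, §3 (11)] -/
theorem kochTataruBilinear_eq_integral_prod {u v : ℝ → E → E}
    (hu : AEStronglyMeasurable (uncurry u) ((volume : Measure (ℝ × E)).restrict (Ioi 0 ×ˢ univ)))
    (hv : AEStronglyMeasurable (uncurry v) ((volume : Measure (ℝ × E)).restrict (Ioi 0 ×ˢ univ)))
    (huX : eKochTataruNorm u < ∞) (hvX : eKochTataruNorm v < ∞) {t : ℝ} (ht : 0 < t) (x : E) :
    kochTataruBilinear u v t x =
      ∫ p in Ioo 0 t ×ˢ (univ : Set E), oseenKernel (t - p.1) (x - p.2) (u p.1 p.2) (v p.1 p.2) := by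
  have hint := integrable_oseenKernel_duhamel hu hv huX hvX ht x
  rw [FluidPDE.volume_restrict_prod_univ_eq_prod] at hint ⊢
  rw [integral_prod _ hint]
  rfl

variable (E) in
/-- **The `L^∞` estimate for the Duhamel term, real-valued form** of
`exists_enorm_kochTataruBilinear_le` (Koch–Tataru 2001, (12) with Lemma 3.1: the `L^∞` part of
`‖V∇ΠN‖_X`; Lemarié-Rieusset 2016, Thm. 9.1): there is `C = C(E)` such that for all `u`, `v`
measurable on `(0, ∞) × E` with finite path norms, every `t > 0` and **every** `x`,
`‖B(u, v)(t, x)‖ ≤ C t^{-1/2} ‖u‖_X ‖v‖_X`. [cite: KochTataruAdvMath2001, Lemma 3.2 (12)] -/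
theorem exists_norm_kochTataruBilinear_le_rpow :
    ∃ C : ℝ, 0 < C ∧ ∀ {u v : ℝ → E → E},
      AEStronglyMeasurable (uncurry u) ((volume : Measure (ℝ × E)).restrict (Ioi 0 ×ˢ univ)) →
      AEStronglyMeasurable (uncurry v) ((volume : Measure (ℝ × E)).restrict (Ioi 0 ×ˢ univ)) →
      eKochTataruNorm u < ∞ → eKochTataruNorm v < ∞ → ∀ {t : ℝ}, 0 < t → ∀ x : E,
        ‖kochTataruBilinear u v t x‖ ≤
          C * t ^ (-(1 / 2 : ℝ)) * (eKochTataruNorm u).toReal * (eKochTataruNorm v).toReal := by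
  obtain ⟨C, hC, h⟩ := exists_enorm_kochTataruBilinear_le (E := E)
  refine ⟨C, hC, fun {u v} hu hv huX hvX {t} ht x => ?_⟩
  have hb := h hu hv ht x
  have hfin : ENNReal.ofReal (C * t ^ (-(1 / 2 : ℝ))) * eKochTataruNorm u * eKochTataruNorm v ≠ ∞ :=
    ENNReal.mul_ne_top (ENNReal.mul_ne_top ENNReal.ofReal_ne_top huX.ne) hvX.ne
  have := ENNReal.toReal_mono hfin hb
  rw [toReal_enorm] at this
  refine this.trans (le_of_eq ?_)
  rw [ENNReal.toReal_mul, ENNReal.toReal_mul, ENNReal.toReal_ofReal (by positivity)]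

end Duhamel




end Literature.Analysis.FluidPDE
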